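import Summits.AtomisticToContinuum.HydrodynamicLimit.Theorems.RelayRaceLocalityNearConstantShortTimeHLIntCapMarkov
import HarnessLib

/-!
# Crux `NearConstantShortTimeHL` (stmt-AtomisticToContinuum-12502), line `small-tilt-domination` (skeleton v23, lead c9):
# Markov bound for the integrated fourth velocity moment along the true law FROM AN EXPONENTIAL (instead of Gaussian) MOMENT

Support file for the crux `…Theses.RelayRaceLocality.NearConstantShortTimeHL`, line `small-tilt-domination`,
registered helper **`intFourthMoment_markovE`** of the stub `stub_reductionPE` (twin of the landed `intFourthMoment_markov`,
`…IntCapMarkov`, in the currency of skeleton v23: super-exponential velocity tails in mean, `…ExpTailDefs`).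

For a hard-sphere flow `Φ` on `𝕋³`, a finite law `P ≪ Liouville` with ONE exponential velocity moment in mean on `[0, t]`,
`E_P n⁻¹ Σᵢ exp (b ‖vᵢ(s)‖) ≤ A` for `s ∈ [0, t]` (`0 < b`), the INTEGRATED fourth-moment cap
`∫₀ᵗ n⁻¹ Σᵢ ‖vᵢ(r)‖⁴ dr ≤ K` fails with probability at most `24 t A / (b⁴ K)`:

* pointwise `x⁴ ≤ (24/b⁴) exp (b x)` for `x ≥ 0` (the quartic Taylor term `(bx)⁴/4! ≤ exp (bx)`,
  `Real.pow_div_factorial_le_exp`), hence `n⁻¹ Σᵢ ‖vᵢ‖⁴ ≤ (24/b⁴) n⁻¹ Σᵢ exp (b ‖vᵢ‖)` for every configuration;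
* replace the flow by its jointly measurable version (`xb_exists_measurable_flow`), which changes nothing on good,
  i.e. `P`-almost all, initial data;
* Markov's inequality for `z ↦ ∫₀ᵗ n⁻¹ Σᵢ ‖vᵢ(r)‖⁴ dr` and Tonelli (`ym_meas_ge_timeIntegral_le`) to evaluate its
  mean as `∫₀ᵗ E_P n⁻¹ Σᵢ ‖vᵢ(r)‖⁴ dr ≤ t · (24/b⁴) A`.

The proof is the landed proof of `intFourthMoment_markov` verbatim with the pointwise Gaussian domination
`ym_ofReal_fourthMoment_le` (`x⁴ ≤ (2/a²) e^{a x²}`) replaced by the exponential one `ye_ofReal_fourthMoment_le`.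
Helpers are prefixed `ye_`. No definitions, no named facts. References: H.-T. Yau, Lett. Math. Phys. 22 (1991) §2 (the
relative-entropy method; this is one of its bookkeeping facts); B. Nachtergaele – H.-T. Yau, Comm. Math. Phys. 243 (2003) §7.2
(super-exponential tails suffice); R. K. Alexander, PhD thesis (1975) Ch. 2 (measurability of the flow).
-/

noncomputable section

namespace Summit.AtomisticToContinuum.HydrodynamicLimit.Theorems.NearConstantShortTimeHL

open scoped BigOperators ENNReal
open MeasureTheory Set Filter
open Literature.MathematicalPhysics.KineticTheory Literature.Analysis.FluidPDE Literature.Analysis.FunctionSpaces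

/-! ## The pointwise bound `x⁴ ≤ (24/b⁴) exp (b x)` -/

-- adapted from `xe_cube_le_exp` (`…MomentPackageE`) and `ym_pow_four_le_exp` (`…IntCapMarkov`)
/-- **Every fourth power is dominated by an exponential moment**: `x⁴ ≤ (24/b⁴) e^{bx}` for `b > 0`, `x ≥ 0` (the quartic
Taylor term `(bx)⁴/4! ≤ e^{bx}`). [folklore] -/
theorem ye_pow_four_le_exp {b : ℝ} (hb : 0 < b) {x : ℝ} (hx : 0 ≤ x) : x ^ 4 ≤ 24 / b ^ 4 * Real.exp (b * x) := by
  have h := Real.pow_div_factorial_le_exp (x := b * x) (by positivity) 4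
  rw [show ((Nat.factorial 4 : ℕ) : ℝ) = 24 by norm_num [Nat.factorial], mul_pow,
    div_le_iff₀ (by norm_num : (0 : ℝ) < 24)] at h
  rw [div_mul_eq_mul_div, le_div_iff₀ (by positivity : (0 : ℝ) < b ^ 4)]
  linarith [h]

/-- The fourth velocity moment per particle is dominated by the exponential velocity moment per particle:
`n⁻¹ Σᵢ ‖vᵢ‖⁴ ≤ (24/b⁴) · n⁻¹ Σᵢ exp (b ‖vᵢ‖)` (`0 < b`). [folklore] -/
theorem ye_fourthMoment_le_expMoment {n : ℕ} {b : ℝ} (hb : 0 < b) (w : Config n (Fin 3) T3) :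
    (n : ℝ)⁻¹ * ∑ i : Fin n, ‖(w i).2‖ ^ 4 ≤
      24 / b ^ 4 * ((n : ℝ)⁻¹ * ∑ i : Fin n, Real.exp (b * ‖(w i).2‖)) := by
  calc (n : ℝ)⁻¹ * ∑ i : Fin n, ‖(w i).2‖ ^ 4
      ≤ (n : ℝ)⁻¹ * ∑ i : Fin n, 24 / b ^ 4 * Real.exp (b * ‖(w i).2‖) :=
        mul_le_mul_of_nonneg_left (Finset.sum_le_sum fun i _ => ye_pow_four_le_exp hb (norm_nonneg (w i).2))
          (inv_nonneg.2 (Nat.cast_nonneg n))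
    _ = 24 / b ^ 4 * ((n : ℝ)⁻¹ * ∑ i : Fin n, Real.exp (b * ‖(w i).2‖)) := by
        rw [← Finset.mul_sum]
        ring

/-- The same domination in `ℝ≥0∞`: `ofReal (n⁻¹ Σᵢ ‖vᵢ‖⁴) ≤ ofReal (24/b⁴) * ofReal (n⁻¹ Σᵢ exp (b ‖vᵢ‖))`. [folklore] -/
theorem ye_ofReal_fourthMoment_le {n : ℕ} {b : ℝ} (hb : 0 < b) (w : Config n (Fin 3) T3) :
    ENNReal.ofReal ((n : ℝ)⁻¹ * ∑ i : Fin n, ‖(w i).2‖ ^ 4) ≤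
      ENNReal.ofReal (24 / b ^ 4) * ENNReal.ofReal ((n : ℝ)⁻¹ * ∑ i : Fin n, Real.exp (b * ‖(w i).2‖)) := by
  rw [← ENNReal.ofReal_mul (by positivity)]
  exact ENNReal.ofReal_le_ofReal (ye_fourthMoment_le_expMoment hb w)

/-! ## The registered helper -/

-- adapted from `intFourthMoment_markov` (`…IntCapMarkov`): Gaussian moment `exp (a ‖v‖²)` → exponential moment `exp (b ‖v‖)`
/-- **Registered helper `intFourthMoment_markovE`.** For a hard-sphere flow `Φ` on `𝕋³` and a finite law `P ≪ Liouville`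
with one exponential velocity moment in mean on `[0, t]`, `E_P n⁻¹ Σᵢ exp (b ‖vᵢ(s)‖) ≤ A` (`s ∈ [0, t]`, `0 < b`), the
integrated fourth-moment cap fails with small probability:
`P {K < ∫₀ᵗ n⁻¹ Σᵢ ‖vᵢ(r)‖⁴ dr} ≤ 24 t A / (b⁴ K)` for every `K > 0`. Proof: `x⁴ ≤ (24/b⁴) exp (b x)` pointwise;
the flow is replaced by its jointly measurable version (`xb_exists_measurable_flow`) off a `P`-null set; Markov's
inequality and Tonelli along `[0, t] × Config` (`ym_meas_ge_timeIntegral_le`). [cite: Yau1991, §2] -/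
theorem intFourthMoment_markovE : ∀ {ε : ℝ} {n : ℕ} (Φ : HardSphereFlow (Torus.geometry (Fin 3)) ε n) (P : Measure (Config n (Fin 3) T3)) [IsFiniteMeasure P], P ≪ liouville (Torus.geometry (Fin 3)) n ε → ∀ {b A t : ℝ}, 0 < b → 0 ≤ A → 0 ≤ t → (∀ s ∈ Set.Icc 0 t, ∫⁻ z, ENNReal.ofReal ((n : ℝ)⁻¹ * ∑ i : Fin n, Real.exp (b * ‖((Φ.flow s z) i).2‖)) ∂P ≤ ENNReal.ofReal A) → ∀ K : ℝ, 0 < K → P {z | ENNReal.ofReal K < ∫⁻ r in Set.Icc 0 t, ENNReal.ofReal ((n : ℝ)⁻¹ * ∑ i : Fin n, ‖((Φ.flow r z) i).2‖ ^ 4)} ≤ ENNReal.ofReal (24 * t * A / b ^ 4 / K) := by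
  intro ε n Φ P _ hP b A t hb hA _ hexp K hK
  obtain ⟨F, hFm, hF⟩ := xb_exists_measurable_flow Φ
  have hgood : ∀ᵐ z ∂P, z ∈ Φ.good := hP.ae_le Φ.ae_mem_good
  -- the jointly measurable integrand (flow replaced by its measurable version)
  have hGm : Measurable fun p : ℝ × Config n (Fin 3) T3 =>
      ENNReal.ofReal ((n : ℝ)⁻¹ * ∑ i : Fin n, ‖((F p) i).2‖ ^ 4) :=
    (ym_measurable_fourthMoment.comp hFm).ennreal_ofReal
  -- the slice means are bounded by `(24/b⁴) A` on `[0, t]`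
  have hB : ∀ r ∈ Icc 0 t,
      ∫⁻ z, ENNReal.ofReal ((n : ℝ)⁻¹ * ∑ i : Fin n, ‖((F (r, z)) i).2‖ ^ 4) ∂P ≤
        ENNReal.ofReal (24 / b ^ 4) * ENNReal.ofReal A := by
    intro r hr
    calc ∫⁻ z, ENNReal.ofReal ((n : ℝ)⁻¹ * ∑ i : Fin n, ‖((F (r, z)) i).2‖ ^ 4) ∂P
        = ∫⁻ z, ENNReal.ofReal ((n : ℝ)⁻¹ * ∑ i : Fin n, ‖((Φ.flow r z) i).2‖ ^ 4) ∂P := by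
          refine lintegral_congr_ae ?_
          filter_upwards [hgood] with z hz
          rw [hF r z hz]
      _ ≤ ∫⁻ z, ENNReal.ofReal (24 / b ^ 4) *
            ENNReal.ofReal ((n : ℝ)⁻¹ * ∑ i : Fin n, Real.exp (b * ‖((Φ.flow r z) i).2‖)) ∂P :=
          lintegral_mono fun z => ye_ofReal_fourthMoment_le hb (Φ.flow r z)
      _ = ENNReal.ofReal (24 / b ^ 4) *
            ∫⁻ z, ENNReal.ofReal ((n : ℝ)⁻¹ * ∑ i : Fin n, Real.exp (b * ‖((Φ.flow r z) i).2‖)) ∂P :=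
          lintegral_const_mul' _ _ ENNReal.ofReal_ne_top
      _ ≤ ENNReal.ofReal (24 / b ^ 4) * ENNReal.ofReal A := by
          gcongr
          exact hexp r hr
  -- Markov and Tonelli for the measurable version
  have hmain : P {z | ENNReal.ofReal K ≤
      ∫⁻ r in Icc 0 t, ENNReal.ofReal ((n : ℝ)⁻¹ * ∑ i : Fin n, ‖((F (r, z)) i).2‖ ^ 4)} ≤
        ENNReal.ofReal (24 / b ^ 4) * ENNReal.ofReal A * ENNReal.ofReal t / ENNReal.ofReal K :=
    ym_meas_ge_timeIntegral_le P hGm t hB (ENNReal.ofReal_pos.2 hK).ne' ENNReal.ofReal_ne_top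
  -- the constants
  have hconst : ENNReal.ofReal (24 / b ^ 4) * ENNReal.ofReal A * ENNReal.ofReal t / ENNReal.ofReal K =
      ENNReal.ofReal (24 * t * A / b ^ 4 / K) := by
    rw [← ENNReal.ofReal_mul (by positivity : (0 : ℝ) ≤ 24 / b ^ 4),
      ← ENNReal.ofReal_mul (mul_nonneg (by positivity : (0 : ℝ) ≤ 24 / b ^ 4) hA),
      ENNReal.ofReal_div_of_pos hK]
    congr 2
    ring
  -- the event along the flow is a.e. contained in the event for the measurable version
  calc P {z | ENNReal.ofReal K <
          ∫⁻ r in Icc 0 t, ENNReal.ofReal ((n : ℝ)⁻¹ * ∑ i : Fin n, ‖((Φ.flow r z) i).2‖ ^ 4)}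
      ≤ P {z | ENNReal.ofReal K ≤
          ∫⁻ r in Icc 0 t, ENNReal.ofReal ((n : ℝ)⁻¹ * ∑ i : Fin n, ‖((F (r, z)) i).2‖ ^ 4)} := by
        refine measure_mono_ae ?_
        filter_upwards [hgood] with z hz h
        change ENNReal.ofReal K ≤ _
        replace h : ENNReal.ofReal K <
            ∫⁻ r in Icc 0 t, ENNReal.ofReal ((n : ℝ)⁻¹ * ∑ i : Fin n, ‖((Φ.flow r z) i).2‖ ^ 4) := h
        refine h.le.trans (le_of_eq (lintegral_congr fun r => ?_))
        rw [hF r z hz]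
    _ ≤ ENNReal.ofReal (24 / b ^ 4) * ENNReal.ofReal A * ENNReal.ofReal t / ENNReal.ofReal K := hmain
    _ = ENNReal.ofReal (24 * t * A / b ^ 4 / K) := hconst

end Summit.AtomisticToContinuum.HydrodynamicLimit.Theorems.NearConstantShortTimeHL

end
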